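import Mathlib
import Literature.NumberTheory.Sieve.BatemanHornProofs

/-!
# Crux `PolyMobiusTail` (stmt-Parity-0870), line `Sketch` (natural form): stub `stub_pointwise`

Pointwise S-expansion: at an argument `n` where no value `fᵢ(n).toNat` equals `1`,
`(-1)^k·routeTail(n,y) − naturalTail(n,y) = Σ_{S ≠ ∅} (-1)^{|univ \\ S|} (∏_{i∈S} log fᵢ(n)) · P_S(n,y)` with
`P_S(n,y) = Σ_{dᵢ ∣ fᵢ(n), ∏dᵢ ≤ y} (∏ μ(dᵢ)) ∏_{i∉S} log dᵢ` (pure algebra: `Finset.prod_add`, Möbius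
inversion `Σ_{d∣m} μ(d) = [m = 1]`, complementary cut-offs).

Registered stub of the lead's skeleton `Summits/Parity/BatemanHorn/Cruxes/PolyMobiusTail/Lines/Sketch.lean`
(namespace `Summit.Parity.BatemanHorn.Cruxes.PolyMobiusTail.NaturalForm`); the statement below is the
registered signature VERBATIM (inline sums, no definitions) and must not be edited.
-/

open scoped BigOperators
open Filter Finset Polynomial Asymptotics

namespace Summit.Parity.BatemanHorn.Theorems.PolyMobiusTail.NaturalForm

/-- Möbius inversion at a point: `Σ_{x ∣ m} μ(x) = 0` (cast to `ℝ`) whenever `m ≠ 1`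
(for `m = 0` the divisor set is empty). [folklore] -/
theorem pointwise_sum_divisors_moebius_eq_zero {m : ℕ} (hm : m ≠ 1) :
    ∑ x ∈ m.divisors, (ArithmeticFunction.moebius x : ℝ) = 0 := by
  rw [← Int.cast_sum, ← ArithmeticFunction.coe_mul_zeta_apply,
    ArithmeticFunction.moebius_mul_coe_zeta, ArithmeticFunction.one_apply_ne hm, Int.cast_zero]

/-- For a non-empty index set `S`, the untruncated signed sum
`Σ_{d : dᵢ ∣ mᵢ} (∏ᵢ μ(dᵢ)) ∏_{i ∉ S} log dᵢ` factorises over the coordinates and the factor at any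
`i₀ ∈ S` is `Σ_{x ∣ m_{i₀}} μ(x) = 0` (as `m_{i₀} ≠ 1`). [folklore] -/
theorem pointwise_full_sum_eq_zero {k : ℕ} (m : Fin k → ℕ) (hm : ∀ i, m i ≠ 1)
    {S : Finset (Fin k)} (hS : S.Nonempty) :
    ∑ d ∈ Fintype.piFinset (fun i => (m i).divisors),
      (∏ i, (ArithmeticFunction.moebius (d i) : ℝ)) * ∏ i ∈ Finset.univ \ S, Real.log (d i) = 0 := by
  obtain ⟨i₀, hi₀⟩ := hS
  have hi₀' : i₀ ∉ Finset.univ \ S := fun h => (Finset.mem_sdiff.mp h).2 hi₀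
  have h1 : ∀ d : Fin k → ℕ,
      (∏ i, (ArithmeticFunction.moebius (d i) : ℝ)) * ∏ i ∈ Finset.univ \ S, Real.log (d i)
        = ∏ i, ((ArithmeticFunction.moebius (d i) : ℝ) *
            if i ∈ Finset.univ \ S then Real.log (d i) else 1) := by
    intro d
    rw [Finset.prod_mul_distrib, Finset.prod_ite_mem, Finset.univ_inter]
  rw [Finset.sum_congr rfl fun d _ => h1 d]
  rw [← Finset.prod_univ_sum (fun i => (m i).divisors)
    (fun i x => (ArithmeticFunction.moebius x : ℝ) * if i ∈ Finset.univ \ S then Real.log x else 1)]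
  refine Finset.prod_eq_zero (Finset.mem_univ i₀) ?_
  simp only [if_neg hi₀', mul_one]
  exact pointwise_sum_divisors_moebius_eq_zero (hm i₀)

/-- Binomial expansion `∏ᵢ μᵢ (Lᵢ - ℓᵢ) = Σ_S (-1)^{|univ \ S|} (∏_{i∈S} Lᵢ) · (∏ᵢ μᵢ) ∏_{i∉S} ℓᵢ`
(`Finset.prod_add`, then merging `(∏_S μ)(∏_{univ \ S} μ) = ∏ μ`). [folklore] -/
theorem pointwise_prod_expand {k : ℕ} (μ L ℓ : Fin k → ℝ) :
    ∏ i, (μ i * (L i - ℓ i)) = ∑ S ∈ (Finset.univ : Finset (Fin k)).powerset,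
      (-1 : ℝ) ^ (Finset.univ \ S).card * (∏ i ∈ S, L i) *
        ((∏ i, μ i) * ∏ i ∈ Finset.univ \ S, ℓ i) := by
  have h : ∀ i, μ i * (L i - ℓ i) = μ i * L i + -(μ i * ℓ i) := fun i => by ring
  simp_rw [h]
  rw [Finset.prod_add]
  refine Finset.sum_congr rfl fun S _ => ?_
  rw [Finset.prod_neg, Finset.prod_mul_distrib, Finset.prod_mul_distrib,
    ← Finset.prod_mul_prod_compl S μ, Finset.compl_eq_univ_sdiff]
  ring

/-- The non-empty members of a family of finsets are the family with `∅` erased. [folklore] -/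
theorem pointwise_filter_nonempty_eq_erase {β : Type*} [DecidableEq β] (T : Finset (Finset β)) :
    T.filter (fun S => S.Nonempty) = T.erase ∅ := by
  rw [← Finset.filter_ne']
  exact Finset.filter_congr fun S _ => Finset.nonempty_iff_ne_empty

/-- Abstract bookkeeping behind the pointwise identity: if the "natural" weight `N` expands as
`Σ_{S ∈ T} c_S · W_S`, the `S = e` term reproduces `a ·` the "route" weight `R`, and every other
untruncated sum `Σ_d W_S(d)` vanishes, then `a · Σ_{p} R - Σ_{p} N = Σ_{S ≠ e} c_S Σ_{¬p} W_S`
(complementary cut-offs `q ↔ ¬ p`). [folklore] -/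
theorem pointwise_assembly {α β : Type*} (D : Finset α) (T T' : Finset β) (e : β)
    (hT : ∀ g : β → ℝ, ∑ S ∈ T, g S = g e + ∑ S ∈ T', g S)
    (p q : α → Prop) [DecidablePred p] [DecidablePred q] (hpq : ∀ d, q d ↔ ¬p d)
    (R N : α → ℝ) (W : β → α → ℝ) (c : β → ℝ) (a : ℝ)
    (hN : ∀ d ∈ D, N d = ∑ S ∈ T, c S * W S d)
    (h0 : ∀ d ∈ D, c e * W e d = a * R d)
    (hS : ∀ S ∈ T', ∑ d ∈ D, W S d = 0) :
    a * (∑ d ∈ D, if p d then R d else 0) - (∑ d ∈ D, if p d then N d else 0)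
      = ∑ S ∈ T', c S * ∑ d ∈ D, if q d then W S d else 0 := by
  have h1 : (∑ d ∈ D, if p d then N d else 0)
      = ∑ S ∈ T, c S * ∑ d ∈ D, if p d then W S d else 0 := by
    have h : ∀ d ∈ D, (if p d then N d else 0) = ∑ S ∈ T, c S * (if p d then W S d else 0) := by
      intro d hd
      by_cases hp : p d
      · simp only [if_pos hp]
        exact hN d hd
      · simp only [if_neg hp, mul_zero, Finset.sum_const_zero]
    rw [Finset.sum_congr rfl h, Finset.sum_comm]
    refine Finset.sum_congr rfl fun S _ => ?_
    rw [Finset.mul_sum]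
  have h2 : ∑ S ∈ T, c S * (∑ d ∈ D, if p d then W S d else 0)
      = c e * (∑ d ∈ D, if p d then W e d else 0)
        + ∑ S ∈ T', c S * ∑ d ∈ D, if p d then W S d else 0 := hT _
  have h3 : c e * (∑ d ∈ D, if p d then W e d else 0)
      = a * ∑ d ∈ D, if p d then R d else 0 := by
    rw [Finset.mul_sum, Finset.mul_sum]
    refine Finset.sum_congr rfl fun d hd => ?_
    by_cases hp : p d
    · simp only [if_pos hp]
      exact h0 d hd
    · simp only [if_neg hp, mul_zero]
  have h4 : ∀ S ∈ T', (∑ d ∈ D, if p d then W S d else 0)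
      = -∑ d ∈ D, if q d then W S d else 0 := by
    intro S hS'
    have hadd : (∑ d ∈ D, if p d then W S d else 0) + (∑ d ∈ D, if q d then W S d else 0)
        = ∑ d ∈ D, W S d := by
      rw [← Finset.sum_add_distrib]
      refine Finset.sum_congr rfl fun d _ => ?_
      by_cases hp : p d
      · rw [if_pos hp, if_neg (fun hq => (hpq d).mp hq hp), add_zero]
      · rw [if_neg hp, if_pos ((hpq d).mpr hp), zero_add]
    linear_combination hadd + hS S hS'
  have h5 : ∑ S ∈ T', c S * (∑ d ∈ D, if p d then W S d else 0)
      = -∑ S ∈ T', c S * ∑ d ∈ D, if q d then W S d else 0 := by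
    rw [← Finset.sum_neg_distrib]
    refine Finset.sum_congr rfl fun S hS' => ?_
    rw [h4 S hS', mul_neg]
  linear_combination (-1 : ℝ) * h1 - h2 - h3 - h5

/-- The pointwise identity with the polynomial values abstracted to `m : Fin k → ℕ`, none equal
to `1`: `(-1)^k · route - natural = Σ_{S ≠ ∅} (-1)^{|univ \ S|} (∏_{i∈S} log mᵢ) · P_S`. [folklore] -/
theorem pointwise_nat (k : ℕ) (m : Fin k → ℕ) (hm : ∀ i, m i ≠ 1) (y : ℝ) :
    (-1 : ℝ) ^ k * (∑ d ∈ Fintype.piFinset (fun i => (m i).divisors),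
        if y < ∏ i, (d i : ℝ) then ∏ i, ((ArithmeticFunction.moebius (d i) : ℝ) * Real.log (d i))
        else 0)
      - (∑ d ∈ Fintype.piFinset (fun i => (m i).divisors),
        if y < ∏ i, (d i : ℝ) then
          ∏ i, ((ArithmeticFunction.moebius (d i) : ℝ) *
            Real.log (((m i : ℕ) : ℝ) / (d i : ℝ))) else 0)
    = ∑ S ∈ (Finset.univ : Finset (Fin k)).powerset.filter (fun S => S.Nonempty),
        (-1 : ℝ) ^ (Finset.univ \ S).card * (∏ i ∈ S, Real.log ((m i : ℕ) : ℝ)) *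
          ∑ d ∈ Fintype.piFinset (fun i => (m i).divisors),
            if ∏ i, (d i : ℝ) ≤ y then
              (∏ i, (ArithmeticFunction.moebius (d i) : ℝ)) * ∏ i ∈ Finset.univ \ S, Real.log (d i)
            else 0 := by
  have hmem : ∀ d ∈ Fintype.piFinset (fun i => (m i).divisors), ∀ i,
      ((m i : ℕ) : ℝ) ≠ 0 ∧ ((d i : ℕ) : ℝ) ≠ 0 := by
    intro d hd i
    have hi := Fintype.mem_piFinset.mp hd i
    exact ⟨Nat.cast_ne_zero.mpr (Nat.mem_divisors.mp hi).2,
      Nat.cast_ne_zero.mpr (Nat.pos_of_mem_divisors hi).ne'⟩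
  have hN : ∀ d ∈ Fintype.piFinset (fun i => (m i).divisors),
      ∏ i, ((ArithmeticFunction.moebius (d i) : ℝ) * Real.log (((m i : ℕ) : ℝ) / (d i : ℝ)))
        = ∑ S ∈ (Finset.univ : Finset (Fin k)).powerset,
          (-1 : ℝ) ^ (Finset.univ \ S).card * (∏ i ∈ S, Real.log ((m i : ℕ) : ℝ)) *
            ((∏ i, (ArithmeticFunction.moebius (d i) : ℝ)) *
              ∏ i ∈ Finset.univ \ S, Real.log (d i)) := by
    intro d hd
    have he : ∏ i, ((ArithmeticFunction.moebius (d i) : ℝ) * Real.log (((m i : ℕ) : ℝ) / (d i : ℝ)))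
        = ∏ i, ((ArithmeticFunction.moebius (d i) : ℝ) *
            (Real.log ((m i : ℕ) : ℝ) - Real.log ((d i : ℕ) : ℝ))) :=
      Finset.prod_congr rfl fun i _ => by rw [Real.log_div (hmem d hd i).1 (hmem d hd i).2]
    rw [he]
    exact pointwise_prod_expand (fun i => (ArithmeticFunction.moebius (d i) : ℝ))
      (fun i => Real.log ((m i : ℕ) : ℝ)) (fun i => Real.log ((d i : ℕ) : ℝ))
  have h0 : ∀ d ∈ Fintype.piFinset (fun i => (m i).divisors),
      (-1 : ℝ) ^ (Finset.univ \ (∅ : Finset (Fin k))).card *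
          (∏ i ∈ (∅ : Finset (Fin k)), Real.log ((m i : ℕ) : ℝ)) *
          ((∏ i, (ArithmeticFunction.moebius (d i) : ℝ)) *
            ∏ i ∈ Finset.univ \ (∅ : Finset (Fin k)), Real.log (d i))
        = (-1 : ℝ) ^ k * ∏ i, ((ArithmeticFunction.moebius (d i) : ℝ) * Real.log (d i)) := by
    intro d _
    rw [Finset.sdiff_empty, Finset.card_univ, Fintype.card_fin, Finset.prod_empty, mul_one,
      ← Finset.prod_mul_distrib]
  have hS : ∀ S ∈ (Finset.univ : Finset (Fin k)).powerset.filter (fun S => S.Nonempty),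
      ∑ d ∈ Fintype.piFinset (fun i => (m i).divisors),
        (∏ i, (ArithmeticFunction.moebius (d i) : ℝ)) * ∏ i ∈ Finset.univ \ S, Real.log (d i)
          = 0 :=
    fun S hS => pointwise_full_sum_eq_zero m hm (Finset.mem_filter.mp hS).2
  have hsplit : ∀ g : Finset (Fin k) → ℝ, ∑ S ∈ (Finset.univ : Finset (Fin k)).powerset, g S
      = g ∅ + ∑ S ∈ (Finset.univ : Finset (Fin k)).powerset.filter (fun S => S.Nonempty), g S := by
    intro g
    rw [← Finset.add_sum_erase (Finset.univ : Finset (Fin k)).powerset g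
      (Finset.empty_mem_powerset _), pointwise_filter_nonempty_eq_erase]
  exact pointwise_assembly (Fintype.piFinset (fun i => (m i).divisors)) _ _ ∅ hsplit
    (fun d => y < ∏ i, (d i : ℝ)) (fun d => ∏ i, (d i : ℝ) ≤ y) (fun d => not_lt.symm)
    (fun d => ∏ i, ((ArithmeticFunction.moebius (d i) : ℝ) * Real.log (d i)))
    (fun d => ∏ i, ((ArithmeticFunction.moebius (d i) : ℝ) *
      Real.log (((m i : ℕ) : ℝ) / (d i : ℝ))))
    (fun S d => (∏ i, (ArithmeticFunction.moebius (d i) : ℝ)) *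
      ∏ i ∈ Finset.univ \ S, Real.log (d i))
    (fun S => (-1 : ℝ) ^ (Finset.univ \ S).card * ∏ i ∈ S, Real.log ((m i : ℕ) : ℝ))
    ((-1 : ℝ) ^ k) hN h0 hS

/-- **Stub `stub_pointwise`.** For `f : Fin k → ℤ[X]`, `y : ℝ`, `n : ℕ` with no `fᵢ(n).toNat = 1`: `(-1)^k` times the route tail summand minus the natural tail summand equals the signed sum over non-empty `S` of `(∏_{i∈S} log fᵢ(n)) · P_S(n, y)`. [folklore] -/
theorem stub_pointwise : ∀ (k : ℕ) (f : Fin k → ℤ[X]) (y : ℝ) (n : ℕ),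
    (∀ i, ((f i).eval (n : ℤ)).toNat ≠ 1) →
    (-1 : ℝ) ^ k * (∑ d ∈ Fintype.piFinset (fun i => (((f i).eval (n : ℤ)).toNat).divisors),
        if y < ∏ i, (d i : ℝ) then ∏ i, ((ArithmeticFunction.moebius (d i) : ℝ) * Real.log (d i)) else 0)
      - (∑ d ∈ Fintype.piFinset (fun i => (((f i).eval (n : ℤ)).toNat).divisors),
        if y < ∏ i, (d i : ℝ) then
          ∏ i, ((ArithmeticFunction.moebius (d i) : ℝ) *
            Real.log ((((f i).eval (n : ℤ)).toNat : ℝ) / (d i : ℝ))) else 0)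
    = ∑ S ∈ (Finset.univ : Finset (Fin k)).powerset.filter (fun S => S.Nonempty),
        (-1 : ℝ) ^ (Finset.univ \ S).card * (∏ i ∈ S, Real.log ((((f i).eval (n : ℤ)).toNat : ℝ))) *
          ∑ d ∈ Fintype.piFinset (fun i => (((f i).eval (n : ℤ)).toNat).divisors),
            if ∏ i, (d i : ℝ) ≤ y then
              (∏ i, (ArithmeticFunction.moebius (d i) : ℝ)) * ∏ i ∈ Finset.univ \ S, Real.log (d i)
            else 0 := by
  intro k f y n h
  exact pointwise_nat k (fun i => ((f i).eval (n : ℤ)).toNat) h y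

end Summit.Parity.BatemanHorn.Theorems.PolyMobiusTail.NaturalForm
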